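import Mathlib

/-!
# The TANGENCY DEFECT `T = W − (⟨W, P⟩/‖P‖²)•P` along a one-parameter family: its `s`-derivative
# (abstract calculus brick for the linearised normal-velocity map of clause 13-J)

Route `FilamentSkeletonRss`, toward child **28296 `Clause13NearStraight`** of `SkeletonJ1G` (stmt-27849).  In the crux,
`T Z j τ = W − (⟪W, Z_j′τ⟫/‖Z_j′τ‖²)•Z_j′τ` with `W = u Z (Z j τ) + ½ Z j τ − α e₃ × Z j τ`; along `Z = X + sY` both `W` and the
tangent `P(s) = X_j′τ + s Y_j′τ` move.  This file is the finite-dimensional calculus of that projection: for `HasDerivAt W W′ s`,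
`HasDerivAt P P′ s`, `P s ≠ 0`, the defect `s ↦ W s − (⟪W s, P s⟫/‖P s‖²)•P s` has an explicit derivative
(`hasDerivAt_tangencyDefect`), and at a point of EXACT TANGENCY with UNIT tangent (`W s = w•P s`, `‖P s‖ = 1` — the crux's
in-ball clause and unit-speed parametrisation) it simplifies to `W′ − ⟪W′, P⟫•P + (w⟪P, P′⟫)•P − w•P′`
(`hasDerivAt_tangencyDefect_unit`): the normal projection of `W′` minus `w` times the normal part of the tangent variation.
With `…MatchedKernelVariationPoint.matchedBiotSavart_hasDerivAt_movingPoint` (the `W′` of the velocity term) this assembles the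
linearised map `Y ↦ d/ds T(X+sY)|₀` filament by filament.  Lane ns-filament-19175-p1 g12; `--supports stmt-…-28296 --as helper`.
HONEST FRAMING: calculus for a HYPOTHETICAL filament skeleton on the NEGATIVE side of a MODEL route; nothing here bears on
Navier–Stokes regularity or blow-up.
-/

noncomputable section

open scoped InnerProductSpace
open Filter Topology

namespace Summit.NavierStokesRegularity.NavierStokesRegularity.Theorems.MatchedKernel
set_option linter.dupNamespace false

/-- The tangential coefficient `s ↦ ⟪W s, P s⟫/‖P s‖²` has the quotient-rule derivative (where `P s ≠ 0`). [folklore] -/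
theorem hasDerivAt_tangentialCoeff {W P : ℝ → EuclideanSpace ℝ (Fin 3)} {W' P' : EuclideanSpace ℝ (Fin 3)} {s : ℝ}
    (hW : HasDerivAt W W' s) (hP : HasDerivAt P P' s) (hP0 : P s ≠ 0) :
    HasDerivAt (fun s => ⟪W s, P s⟫_ℝ / ‖P s‖ ^ 2)
      (((⟪W s, P'⟫_ℝ + ⟪W', P s⟫_ℝ) * ‖P s‖ ^ 2 - ⟪W s, P s⟫_ℝ * (2 * ⟪P s, P'⟫_ℝ)) / (‖P s‖ ^ 2) ^ 2) s := by
  have h1 : HasDerivAt (fun s => ⟪W s, P s⟫_ℝ) (⟪W s, P'⟫_ℝ + ⟪W', P s⟫_ℝ) s := hW.inner ℝ hP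
  have h2 : HasDerivAt (fun s => ‖P s‖ ^ 2) (2 * ⟪P s, P'⟫_ℝ) s := hP.norm_sq
  have hne : ‖P s‖ ^ 2 ≠ 0 := by positivity
  exact h1.div h2 hne

/-- **The derivative of the tangency defect** `s ↦ W s − (⟪W s, P s⟫/‖P s‖²)•P s` (where `P s ≠ 0`). [folklore] -/
theorem hasDerivAt_tangencyDefect {W P : ℝ → EuclideanSpace ℝ (Fin 3)} {W' P' : EuclideanSpace ℝ (Fin 3)} {s : ℝ}
    (hW : HasDerivAt W W' s) (hP : HasDerivAt P P' s) (hP0 : P s ≠ 0) :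
    HasDerivAt (fun s => W s - (⟪W s, P s⟫_ℝ / ‖P s‖ ^ 2) • P s)
      (W' - ((⟪W s, P s⟫_ℝ / ‖P s‖ ^ 2) • P'
        + (((⟪W s, P'⟫_ℝ + ⟪W', P s⟫_ℝ) * ‖P s‖ ^ 2 - ⟪W s, P s⟫_ℝ * (2 * ⟪P s, P'⟫_ℝ)) / (‖P s‖ ^ 2) ^ 2) • P s)) s :=
  hW.sub ((hasDerivAt_tangentialCoeff hW hP hP0).smul hP)

/-- **At exact tangency with unit tangent** (`W s = w•P s`, `‖P s‖ = 1`): the derivative of the defect is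
`W′ − ⟪W′, P⟫•P + (w⟪P, P′⟫)•P − w•P′`. [folklore] -/
theorem hasDerivAt_tangencyDefect_unit {W P : ℝ → EuclideanSpace ℝ (Fin 3)} {W' P' : EuclideanSpace ℝ (Fin 3)} {s w : ℝ}
    (hW : HasDerivAt W W' s) (hP : HasDerivAt P P' s) (hP1 : ‖P s‖ = 1) (hWs : W s = w • P s) :
    HasDerivAt (fun s => W s - (⟪W s, P s⟫_ℝ / ‖P s‖ ^ 2) • P s)
      (W' - ⟪W', P s⟫_ℝ • P s + (w * ⟪P s, P'⟫_ℝ) • P s - w • P') s := by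
  have hP0 : P s ≠ 0 := by
    intro h; rw [h, norm_zero] at hP1; exact zero_ne_one hP1
  have h := hasDerivAt_tangencyDefect hW hP hP0
  have hPP : ⟪P s, P s⟫_ℝ = 1 := by rw [real_inner_self_eq_norm_sq, hP1, one_pow]
  have hWP : ⟪W s, P s⟫_ℝ = w := by rw [hWs, real_inner_smul_left, hPP, mul_one]
  have hWP' : ⟪W s, P'⟫_ℝ = w * ⟪P s, P'⟫_ℝ := by rw [hWs, real_inner_smul_left]
  refine h.congr_deriv ?_
  rw [hP1, hWP, hWP']
  simp only [one_pow, mul_one, div_one]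
  rw [show (w * ⟪P s, P'⟫_ℝ + ⟪W', P s⟫_ℝ - w * (2 * ⟪P s, P'⟫_ℝ)) = ⟪W', P s⟫_ℝ - w * ⟪P s, P'⟫_ℝ by ring, sub_smul]
  abel

/-- The normal part of the UNIT-case derivative is indeed normal: `⟪W′ − ⟪W′,P⟫P + (w⟪P,P′⟫)P − wP′, P⟫ = 0` whenever
`‖P‖ = 1` and `⟪P, P′⟫ = 0` (unit-speed curves have `X′ ⊥ X″`; for the variation `P′ = Y′` of a normal field use
`⟪Y′, X′⟫ = −⟪Y, X″⟫` separately). [folklore] -/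
theorem inner_tangencyDefectDeriv_eq_zero {P W' P' : EuclideanSpace ℝ (Fin 3)} {w : ℝ} (hP1 : ‖P‖ = 1) (hPP' : ⟪P, P'⟫_ℝ = 0) :
    ⟪W' - ⟪W', P⟫_ℝ • P + (w * ⟪P, P'⟫_ℝ) • P - w • P', P⟫_ℝ = 0 := by
  have hPP : ⟪P, P⟫_ℝ = 1 := by rw [real_inner_self_eq_norm_sq, hP1, one_pow]
  have hP'P : ⟪P', P⟫_ℝ = 0 := by rw [real_inner_comm]; exact hPP'
  rw [inner_sub_left, inner_add_left, inner_sub_left, real_inner_smul_left, real_inner_smul_left, real_inner_smul_left,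
    hPP, hP'P, hPP']
  ring

end Summit.NavierStokesRegularity.NavierStokesRegularity.Theorems.MatchedKernel
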